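import Literature.Probability.Percolation.TrapFramesReroute
import Literature.Probability.Percolation.IntFenceAttach
import HarnessLib

/-!
# The six-frame protocol at internal extremities (twin of `TrapFramesReroute.lean`)

Topic: Probability / Percolation; family `crit-perc` (site percolation on the triangular lattice
`𝕋 = triGraph`). The INNER twin of `TrapFramesReroute.lean`: the six-step rerouting protocol of
all arms of one colour, run in the half-annuli `intDom m` of internal extremities read through
the six rotations `ρ^0, …, ρ^5` (Nolin 2008, Thm. 11, internal extremities [arXiv 0711.4948:
Thm. 10, p. 13]; Kesten–Sidoravicius–Zhang 1998, App. §7). Members are open `𝕋`-connected sets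
of sites of norm `≥ m` containing their start, a site outside `Λ_{2m}` (an outer-landed arm read
from its outer end), so that they enter every half-annulus only through its start set
(`intDom_entry`). The transport (`frameRd`) is that of `TrapFramesReroute.lean`.

## Main definitions

* `IntFrameTransversals m χ` — a closed transversal of `rotConfig i χ` in `intDom m` for every
  frame `i`; `nonempty_intFrameTransversals` (`5 ≤ m`).
* `𝒯.term`, `𝒯.step`, `𝒯.iter`, `𝒯.termAt`, `𝒯.lastFrame`, `𝒯.final`, `IntFrameTransversals.MemberOK`.

## Main results

* `memberOK_step`, `disjoint_step`, `step_eq_self_of_term_eq_none`, `rot_tip_mem_step`,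
  `term_ne_none_of_mem_J`, `term_ne_of_disjoint`; `memberOK_final`, `disjoint_final`,
  `termAt_lastFrame_ne_none` (every member with a site read on the tip arc of some frame is
  settled), `rot_tip_mem_final`, `termAt_ne_of_disjoint`, `frameRd_final`, `frameRd_final_other`.

## References

* P. Nolin, *Near-critical percolation in two dimensions*, Electron. J. Probab. 13 (2008), §4.4,
  proof of Thm. 11 and Lemma 15, internal extremities [arXiv 0711.4948: Thm. 10, Lemma 14,
  p. 13]. [Nolin2008]
* H. Kesten, V. Sidoravicius, Y. Zhang, *Almost all words are seen in critical site percolation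
  on the triangular lattice*, Electron. J. Probab. 3 (1998), paper 10, App. §7 (7.9)–(7.10),
  p. 27. [KestenSidoraviciusZhang1998]
-/

noncomputable section

namespace Literature.Probability.Percolation

open LatticeModels HalfAnnulus

open JDomain

/-! ### The six-step protocol -/

/-- **Transversals of the six frames**: for each frame `i`, a closed transversal of the rotated
configuration `rotConfig i χ` in the half-annulus `intDom m` of internal extremities. [cite: KestenSidoraviciusZhang1998, App. §7 (7.10) p. 27] -/
structure IntFrameTransversals (m : ℕ) (χ : SiteConfig (Site 2)) where
  /-- the transversal of frame `i` -/
  τ : (i : ℕ) → (intDom m).Transversal (rotConfig i χ)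

/-- Transversals of the six inner frames exist (`5 ≤ m`). [cite: KestenSidoraviciusZhang1998, App. §7 (7.10) p. 27] -/
theorem nonempty_intFrameTransversals {m : ℕ} (hm : 5 ≤ m) (χ : SiteConfig (Site 2)) : Nonempty (IntFrameTransversals m χ) :=
  ⟨⟨fun i => Classical.choice (nonempty_transversal (intDom_cutProp hm) (intDom_dualProp hm) (rotConfig i χ))⟩⟩

namespace IntFrameTransversals

variable {m : ℕ} {χ : SiteConfig (Site 2)} (𝒯 : IntFrameTransversals m χ)

/-- **The term chosen in frame `i`** for the actual member `E` with start `a` (`none` if the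
reading of `E` meets no junction of frame `i`). [cite: KestenSidoraviciusZhang1998, App. §7 (7.9) p. 27] -/
def term (i : ℕ) (E : Set (Site 2)) (a : Site 2) : Option ℕ :=
  (𝒯.τ i).firstTerm (frameRd i E) ((triRotIsoPow i).symm a)

/-- **One step of the protocol**: reroute the reading of `E` in frame `i` and read back. [cite: KestenSidoraviciusZhang1998, App. §7 (7.9) p. 27] -/
def step (i : ℕ) (E : Set (Site 2)) (a : Site 2) : Set (Site 2) :=
  triRotIsoPow i '' ((𝒯.τ i).reroute (frameRd i E) ((triRotIsoPow i).symm a))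

/-- **The member after `f` steps** (frames `0, …, f - 1` processed in this order). [cite: Nolin2008, §4.4 (arXiv 0711.4948: proof of Thm. 10, "each of the j arms induces … a crossing of one of the … U-shaped regions")] -/
def iter : ℕ → Set (Site 2) → Site 2 → Set (Site 2)
  | 0, E, _ => E
  | f + 1, E, a => 𝒯.step f (iter f E a) a

/-- The reading of a step in its own frame is the rerouted reading. [folklore] -/
private theorem frameRd_step (i : ℕ) (E : Set (Site 2)) (a : Site 2) :
    frameRd i (𝒯.step i E a) = (𝒯.τ i).reroute (frameRd i E) ((triRotIsoPow i).symm a) :=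
  image_symm_image _ _

/-- The recursion of `iter`. [folklore] -/
private theorem iter_succ (f : ℕ) (E : Set (Site 2)) (a : Site 2) : 𝒯.iter (f + 1) E a = 𝒯.step f (𝒯.iter f E a) a := rfl

/-! ### The invariant of a member -/

/-- **The invariant of an inner member**: open (of the colour `χ`), of norm `≥ m`, containing its
start, `𝕋`-connected from it. [folklore] -/
structure MemberOK (m : ℕ) (χ E : Set (Site 2)) (a : Site 2) : Prop where
  subset : E ⊆ χ
  norm_ge : ∀ v ∈ E, (m : ℤ) ≤ triNorm v
  start_mem : a ∈ E
  conn : ∀ x ∈ E, PathIn triGraph E a x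

variable {𝒯}

section Step

variable {i : ℕ} {E E' : Set (Site 2)} {a a' : Site 2}

/-- The reading keeps lower norm bounds. [folklore] -/
theorem triNorm_ge_of_mem_frameRd {K : ℤ} (h : ∀ v ∈ E, K ≤ triNorm v) {v : Site 2} (hv : v ∈ frameRd i E) : K ≤ triNorm v := by
  have := h _ (mem_frameRd.1 hv)
  rwa [triNorm_rot] at this

/-- The reading of the start is off the half-annulus (start outside `Λ_{2m}`). [folklore] -/
theorem symm_start_not_mem_D (ha : 2 * (m : ℤ) < triNorm a) : (triRotIsoPow i).symm a ∉ (intDom m).D :=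
  not_mem_intDom_D_of_gt (by rwa [triNorm_rot_symm])

/-- The reading of the start is off the transversal. [folklore] -/
theorem symm_start_not_mem_T (ha : 2 * (m : ℤ) < triNorm a) : (triRotIsoPow i).symm a ∉ (𝒯.τ i).T :=
  fun h => symm_start_not_mem_D ha (Finset.mem_coe.1 ((𝒯.τ i).T_subset h))

/-- **A step preserves the invariant.** [cite: KestenSidoraviciusZhang1998, App. §7 (7.9) p. 27] -/
theorem memberOK_step (hm : 5 ≤ m) (hE : MemberOK m χ E a) (ha : 2 * (m : ℤ) < triNorm a) :
    MemberOK m χ (𝒯.step i E a) a := by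
  have hcut := intDom_cutProp hm
  have hrd : frameRd i E ⊆ rotConfig i χ := frameRd_subset_rotConfig hE.subset
  refine ⟨?_, ?_, ?_, ?_⟩
  · rintro _ ⟨w, hw, rfl⟩
    exact mem_rotConfig.1 (Transversal.reroute_subset_of_subset hrd hw)
  · rintro _ ⟨w, hw, rfl⟩
    rw [triNorm_rot]
    cases h : (𝒯.τ i).firstTerm (frameRd i E) ((triRotIsoPow i).symm a) with
    | none =>
      rw [Transversal.mem_reroute_iff_of_none h] at hw
      exact triNorm_ge_of_mem_frameRd hE.norm_ge (Transversal.comp_subset hw)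
    | some u =>
      obtain ⟨⟨⟨c, z⟩, hu⟩, -, -⟩ := Transversal.firstTerm_spec h
      rcases Transversal.reroute_subset_union h hu hw with hw | hw
      · exact triNorm_ge_of_mem_frameRd hE.norm_ge hw
      · have hwD := (isCrossing_of_lowestSeq hu).1.subset (Finset.mem_coe.1 hw)
        rw [intDom_D] at hwD
        exact (mem_haFin.1 hwD).2.1
  · refine ⟨(triRotIsoPow i).symm a, Transversal.start_mem_reroute ?_ (symm_start_not_mem_T ha), RelIso.apply_symm_apply _ a⟩
    exact mem_frameRd.2 (by rw [RelIso.apply_symm_apply]; exact hE.start_mem)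
  · rintro _ ⟨w, hw, rfl⟩
    have h := pathIn_map_iso (triRotIsoPow i) (Transversal.pathIn_reroute hcut hw)
    rwa [RelIso.apply_symm_apply] at h

/-- **A step preserves disjointness** (starts in `Λ_M`, members inside `Λ_{2M}`: the readings enter
the trapezoid only through its inner side). [cite: KestenSidoraviciusZhang1998, App. §7 (7.9) p. 27] -/
theorem disjoint_step (hm : 5 ≤ m) (hE : MemberOK m χ E a) (hE' : MemberOK m χ E' a') (ha : 2 * (m : ℤ) < triNorm a)
    (ha' : 2 * (m : ℤ) < triNorm a') (h : Disjoint E E') : Disjoint (𝒯.step i E a) (𝒯.step i E' a') := by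
  refine disjoint_image_iso _ (Transversal.disjoint_reroute (intDom_cutProp hm) (disjoint_frameRd h)
    (symm_start_not_mem_D ha) (symm_start_not_mem_D ha') ?_ ?_)
  · exact intDom_entry fun v hv => triNorm_ge_of_mem_frameRd hE.norm_ge hv
  · exact intDom_entry fun v hv => triNorm_ge_of_mem_frameRd hE'.norm_ge hv

/-- **An untouched member is unchanged**: if no term is chosen, the step is the identity (the
reading is open, `𝕋`-connected from a start off `T`, so it misses `T` altogether). [cite: KestenSidoraviciusZhang1998, App. §7 (7.9) p. 27] -/
theorem step_eq_self_of_term_eq_none (hE : MemberOK m χ E a) (ha : 2 * (m : ℤ) < triNorm a) (h : 𝒯.term i E a = none) :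
    𝒯.step i E a = E := by
  have hrd : frameRd i E ⊆ rotConfig i χ := frameRd_subset_rotConfig hE.subset
  have hconn : ∀ x ∈ frameRd i E, PathIn triGraph (frameRd i E) ((triRotIsoPow i).symm a) x := by
    intro x hx
    have := pathIn_frameRd (i := i) (hE.conn _ (mem_frameRd.1 hx))
    rwa [RelIso.symm_apply_apply] at this
  have hdisj : Disjoint (frameRd i E) (𝒯.τ i).T := by
    refine Set.disjoint_left.2 fun y hy hyT => ?_
    exact Transversal.firstTerm_ne_none_of_mem hrd hconn (symm_start_not_mem_T ha) hy hyT h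
  rw [step, Transversal.reroute_eq_self hdisj hconn]
  exact image_image_symm _ _

/-- **A settled member reaches the tip of its term**: if the term `u` (tip `z`) is chosen in frame
`i`, the actual tip `ρ^i z` lies in the new member. [cite: KestenSidoraviciusZhang1998, App. §7 (7.9) p. 27] -/
theorem rot_tip_mem_step (hm : 5 ≤ m) {u : ℕ} {c : Finset (Site 2)} {z : Site 2} (h : 𝒯.term i E a = some u)
    (hu : (intDom m).lowestSeq (rotConfig i χ) u = some (c, z)) : triRotIsoPow i z ∈ 𝒯.step i E a :=
  ⟨z, Transversal.tip_mem_reroute (intDom_cutProp hm) h hu, rfl⟩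

/-- The chosen term exists. [folklore] -/
theorem exists_lowestSeq_of_term {u : ℕ} (h : 𝒯.term i E a = some u) :
    ∃ c z, (intDom m).lowestSeq (rotConfig i χ) u = some (c, z) := by
  obtain ⟨⟨⟨c, z⟩, hu⟩, -, -⟩ := Transversal.firstTerm_spec h
  exact ⟨c, z, hu⟩

/-- **A member with a site read on the tip arc of frame `i` is settled in frame `i`** (`5 ≤ m`). [cite: KestenSidoraviciusZhang1998, App. §7 p. 27] -/
theorem term_ne_none_of_mem_J (hm : 5 ≤ m) (hE : MemberOK m χ E a) (ha : 2 * (m : ℤ) < triNorm a) {y : Site 2} (hy : y ∈ E)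
    (hyJ : (triRotIsoPow i).symm y ∈ (intDom m).J) : 𝒯.term i E a ≠ none := by
  have hrd : frameRd i E ⊆ rotConfig i χ := frameRd_subset_rotConfig hE.subset
  have hconn : ∀ x ∈ frameRd i E, PathIn triGraph (frameRd i E) ((triRotIsoPow i).symm a) x := by
    intro x hx
    have := pathIn_frameRd (i := i) (hE.conn _ (mem_frameRd.1 hx))
    rwa [RelIso.symm_apply_apply] at this
  refine Transversal.firstTerm_ne_none_of_meets_J (intDom_cutProp hm) hrd hconn (symm_start_not_mem_D ha)
    (intDom_entry fun v hv => triNorm_ge_of_mem_frameRd hE.norm_ge hv) ?_ hyJ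
  exact mem_frameRd.2 (by rwa [RelIso.apply_symm_apply])

/-- **Distinct members settled in the same frame use distinct terms.** [cite: KestenSidoraviciusZhang1998, App. §7 (7.9) p. 27] -/
private theorem term_ne_of_disjoint (h : Disjoint E E') {u u' : ℕ} (hu : 𝒯.term i E a = some u) (hu' : 𝒯.term i E' a' = some u') :
    u ≠ u' :=
  Transversal.firstTerm_ne_of_disjoint (disjoint_frameRd h) hu hu'

end Step

/-! ### Iterating over the six frames -/

section Iter

variable {E E' : Set (Site 2)} {a a' : Site 2}

/-- The invariant along the protocol. [folklore] -/
theorem memberOK_iter (hm : 5 ≤ m) (hE : MemberOK m χ E a) (ha : 2 * (m : ℤ) < triNorm a) :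
    ∀ f, MemberOK m χ (𝒯.iter f E a) a
  | 0 => hE
  | f + 1 => memberOK_step hm (memberOK_iter hm hE ha f) ha

/-- **Disjointness along the protocol.** [cite: KestenSidoraviciusZhang1998, App. §7 (7.9) p. 27] -/
theorem disjoint_iter (hm : 5 ≤ m) (hE : MemberOK m χ E a) (hE' : MemberOK m χ E' a') (ha : 2 * (m : ℤ) < triNorm a)
    (ha' : 2 * (m : ℤ) < triNorm a') (h : Disjoint E E') : ∀ f, Disjoint (𝒯.iter f E a) (𝒯.iter f E' a')
  | 0 => h
  | f + 1 => disjoint_step hm (memberOK_iter hm hE ha f) (memberOK_iter hm hE' ha' f) ha ha' (disjoint_iter hm hE hE' ha ha' h f)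

/-- The term chosen at step `f` of the protocol. [folklore] -/
def termAt (𝒯 : IntFrameTransversals m χ) (f : ℕ) (E : Set (Site 2)) (a : Site 2) : Option ℕ := 𝒯.term f (𝒯.iter f E a) a

/-- Untouched steps do not change the member. [folklore] -/
theorem iter_succ_eq_of_termAt_eq_none (hm : 5 ≤ m) (hE : MemberOK m χ E a) (ha : 2 * (m : ℤ) < triNorm a) {f : ℕ}
    (h : 𝒯.termAt f E a = none) : 𝒯.iter (f + 1) E a = 𝒯.iter f E a :=
  step_eq_self_of_term_eq_none (memberOK_iter hm hE ha f) ha h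

/-- A run of untouched steps does not change the member. [folklore] -/
theorem iter_eq_of_forall_none (hm : 5 ≤ m) (hE : MemberOK m χ E a) (ha : 2 * (m : ℤ) < triNorm a) {f g : ℕ} (hfg : f ≤ g)
    (h : ∀ n, f ≤ n → n < g → 𝒯.termAt n E a = none) : 𝒯.iter g E a = 𝒯.iter f E a := by
  induction hfg with
  | refl => rfl
  | @step g hfg ih =>
    rw [iter_succ_eq_of_termAt_eq_none hm hE ha (h g hfg (Nat.lt_succ_self g))]
    exact ih fun n hn hng => h n hn (Nat.lt_succ_of_lt hng)

open Classical in
/-- **The last frame in which the member was settled** (among the frames `0, …, 5`; `0` if none). [cite: Nolin2008, §4.4 (arXiv 0711.4948: proof of Thm. 10)] -/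
def lastFrame (𝒯 : IntFrameTransversals m χ) (E : Set (Site 2)) (a : Site 2) : ℕ :=
  Nat.findGreatest (fun f => 𝒯.termAt f E a ≠ none) 5

/-- `lastFrame < 6`. [folklore] -/
theorem lastFrame_lt_six (E : Set (Site 2)) (a : Site 2) : 𝒯.lastFrame E a < 6 := by
  classical
  exact Nat.lt_succ_of_le (Nat.findGreatest_le 5)

/-- After the last settled frame, the member is untouched. [folklore] -/
private theorem termAt_eq_none_of_lastFrame_lt {f : ℕ} (hf : 𝒯.lastFrame E a < f) (hf5 : f ≤ 5) : 𝒯.termAt f E a = none := by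
  classical
  by_contra h
  exact Nat.findGreatest_is_greatest hf hf5 h

/-- **The final member** (after the six frames). [cite: Nolin2008, §4.4 (arXiv 0711.4948: proof of Thm. 10)] -/
def final (𝒯 : IntFrameTransversals m χ) (E : Set (Site 2)) (a : Site 2) : Set (Site 2) := 𝒯.iter 6 E a

/-- The final member is the member right after its last settled frame. [folklore] -/
theorem final_eq_iter_lastFrame_succ (hm : 5 ≤ m) (hE : MemberOK m χ E a) (ha : 2 * (m : ℤ) < triNorm a) :
    𝒯.final E a = 𝒯.iter (𝒯.lastFrame E a + 1) E a := by
  refine iter_eq_of_forall_none hm hE ha (Nat.succ_le_of_lt (lastFrame_lt_six E a)) ?_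
  intro n hn hn6
  exact termAt_eq_none_of_lastFrame_lt (Nat.lt_of_succ_le hn) (by omega)

/-- **The reading of the final member in its last frame is the rerouted reading of the member at
that step** — the shape to which the fence-attachment and no-invasion theorems apply. [cite: KestenSidoraviciusZhang1998, App. §7 (7.9) p. 27] -/
theorem frameRd_final (hm : 5 ≤ m) (hE : MemberOK m χ E a) (ha : 2 * (m : ℤ) < triNorm a) :
    frameRd (𝒯.lastFrame E a) (𝒯.final E a) =
      (𝒯.τ (𝒯.lastFrame E a)).reroute (frameRd (𝒯.lastFrame E a) (𝒯.iter (𝒯.lastFrame E a) E a))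
        ((triRotIsoPow (𝒯.lastFrame E a)).symm a) := by
  rw [final_eq_iter_lastFrame_succ hm hE ha, iter_succ, frameRd_step]

/-- The final member satisfies the invariant. [folklore] -/
theorem memberOK_final (hm : 5 ≤ m) (hE : MemberOK m χ E a) (ha : 2 * (m : ℤ) < triNorm a) : MemberOK m χ (𝒯.final E a) a :=
  memberOK_iter hm hE ha 6

/-- **Final members of disjoint members are disjoint.** [cite: KestenSidoraviciusZhang1998, App. §7 (7.9) p. 27] -/
theorem disjoint_final (hm : 5 ≤ m) (hE : MemberOK m χ E a) (hE' : MemberOK m χ E' a') (ha : 2 * (m : ℤ) < triNorm a)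
    (ha' : 2 * (m : ℤ) < triNorm a') (h : Disjoint E E') : Disjoint (𝒯.final E a) (𝒯.final E' a') :=
  disjoint_iter hm hE hE' ha ha' h 6

/-- **Every member with a site read on the tip arc of some frame is settled in some frame**
(`5 ≤ m`): if no step settled it, it would be unchanged when that frame is processed, and settled
there. [cite: Nolin2008, §4.4 (arXiv 0711.4948: proof of Thm. 10)] -/
theorem termAt_lastFrame_ne_none (hm : 5 ≤ m) (hE : MemberOK m χ E a) (ha : 2 * (m : ℤ) < triNorm a) {y : Site 2} (hy : y ∈ E)
    (hyJ : ∃ i < 6, (triRotIsoPow i).symm y ∈ (intDom m).J) : 𝒯.termAt (𝒯.lastFrame E a) E a ≠ none := by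
  classical
  obtain ⟨i, hi6, hiJ⟩ := hyJ
  -- some frame `≤ 5` settles the member
  have hex : ∃ f, f ≤ 5 ∧ 𝒯.termAt f E a ≠ none := by
    by_contra hnone
    push Not at hnone
    have hiter : 𝒯.iter i E a = E :=
      iter_eq_of_forall_none hm hE ha (Nat.zero_le i) fun n _ hni => hnone n (by omega)
    have h := term_ne_none_of_mem_J (𝒯 := 𝒯) (i := i) hm hE ha hy hiJ
    exact h (hiter ▸ hnone i (by omega))
  obtain ⟨f, hf5, hf⟩ := hex
  exact Nat.findGreatest_spec (P := fun f => 𝒯.termAt f E a ≠ none) hf5 hf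

/-- **Distinct members settled last in the same frame use distinct terms there.** [cite: KestenSidoraviciusZhang1998, App. §7 (7.9) p. 27] -/
theorem termAt_ne_of_disjoint (hm : 5 ≤ m) (hE : MemberOK m χ E a) (hE' : MemberOK m χ E' a') (ha : 2 * (m : ℤ) < triNorm a)
    (ha' : 2 * (m : ℤ) < triNorm a') (h : Disjoint E E') {f u u' : ℕ} (hu : 𝒯.termAt f E a = some u)
    (hu' : 𝒯.termAt f E' a' = some u') : u ≠ u' :=
  term_ne_of_disjoint (disjoint_iter hm hE hE' ha ha' h f) hu hu'

/-- **The final member reaches the actual tip of its last term.** [cite: KestenSidoraviciusZhang1998, App. §7 (7.9) p. 27] -/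
theorem rot_tip_mem_final (hm : 5 ≤ m) (hE : MemberOK m χ E a) (ha : 2 * (m : ℤ) < triNorm a) {u : ℕ} {c : Finset (Site 2)}
    {z : Site 2} (hu : 𝒯.termAt (𝒯.lastFrame E a) E a = some u)
    (hcz : (intDom m).lowestSeq (rotConfig (𝒯.lastFrame E a) χ) u = some (c, z)) :
    triRotIsoPow (𝒯.lastFrame E a) z ∈ 𝒯.final E a := by
  rw [final_eq_iter_lastFrame_succ hm hE ha, iter_succ]
  exact rot_tip_mem_step hm hu hcz

/-- **The reading of another final member in the last frame of a member**: open, of norm `≥ m`,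
`𝕋`-connected from the reading of its start (outside `Λ_{2m}`), and disjoint from the rerouted
reading — the hypotheses of the no-invasion theorem
`JDomain.Transversal.int_not_mem_of_mem_termFence`. [cite: KestenSidoraviciusZhang1998, App. §7 (7.9) p. 27] -/
theorem frameRd_final_other (hm : 5 ≤ m) (hE : MemberOK m χ E a) (hE' : MemberOK m χ E' a') (ha : 2 * (m : ℤ) < triNorm a)
    (ha' : 2 * (m : ℤ) < triNorm a') (h : Disjoint E E') :
    frameRd (𝒯.lastFrame E a) (𝒯.final E' a') ⊆ rotConfig (𝒯.lastFrame E a) χ ∧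
      (∀ v ∈ frameRd (𝒯.lastFrame E a) (𝒯.final E' a'), (m : ℤ) ≤ triNorm v) ∧
      2 * (m : ℤ) < triNorm ((triRotIsoPow (𝒯.lastFrame E a)).symm a') ∧
      (∀ x ∈ frameRd (𝒯.lastFrame E a) (𝒯.final E' a'),
        PathIn triGraph (frameRd (𝒯.lastFrame E a) (𝒯.final E' a')) ((triRotIsoPow (𝒯.lastFrame E a)).symm a') x) ∧
      Disjoint (frameRd (𝒯.lastFrame E a) (𝒯.final E' a'))
        ((𝒯.τ (𝒯.lastFrame E a)).reroute (frameRd (𝒯.lastFrame E a) (𝒯.iter (𝒯.lastFrame E a) E a))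
          ((triRotIsoPow (𝒯.lastFrame E a)).symm a)) := by
  have hF' := memberOK_final (𝒯 := 𝒯) hm hE' ha'
  refine ⟨frameRd_subset_rotConfig hF'.subset, fun v hv => triNorm_ge_of_mem_frameRd hF'.norm_ge hv,
    by rwa [triNorm_rot_symm], fun x hx => ?_, ?_⟩
  · have := pathIn_frameRd (i := 𝒯.lastFrame E a) (hF'.conn _ (mem_frameRd.1 hx))
    rwa [RelIso.symm_apply_apply] at this
  · rw [← frameRd_final hm hE ha]
    exact (disjoint_frameRd (disjoint_final hm hE hE' ha ha' h)).symm

end Iter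

end IntFrameTransversals

end Literature.Probability.Percolation
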